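import Summits.ABC.IUTFork.Cor312PilotIdelesCapstone
import Summits.ABC.IUTFork.Cor312ProvenanceDHWitness
import HarnessLib

/-!
# Branch C certificate — a KERNEL VACUITY FINDING on the «genuine-setting» family: the idele side condition
# «the q-ideles REALISE `P_q` in the completions of the field of the pilot data» is UNSATISFIABLE for the pilot data
# OF an initial Θ-datum over its own field (Def. 3.1 (c): `l ∤ ord_v(q_v)`), hence so is the per-datum hypothesis group
# of `abc_of_S_v3` / `v4` / `AbcOfSShrink2` / `AbcOfSShrink3` as typed

C scoreboard note (companion of `AbcOfSGenuine.lean` p430884, `AbcOfSShrink2.lean` p430322, `AbcOfSShrink3.lean` p431459; finding of the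
INTAKE seat abc-iut-C-cert-3): the SIDE binders `hX : Cor312Prov.IsPilotDataOf D X` and `htq` (q-ideles realising `P_q`) of every
«genuine-setting» certificate are JOINTLY UNSATISFIABLE — kernel theorem `SideVacuity.not_realising_qIdeles_of_isPilotDataOf` below.
So those certificates (and the refutations that assume REALISING ideles, p430714 / p430998, WHEN read at `X` := the pilot data of
`D` over `F`) hold VACUOUSLY at every genuine datum AS TYPED. Repair named at the end.

PROOF-ONLY record (no `def`, no new `Prop`); elementary valuation theory, all inputs in the tree. The point:

* abc-iut-c312-3's Dupuy–Hilado idele binders read the pilot regions off ideles `t_{q,v} ∈ F_v^×` of the RESCALED completions of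
  the field `F` OF THE PILOT DATA `X : PilotData F` (`Thm311.Real.kOf X p x = RescaledCompletion F p v`, norm `‖·‖' = N(v)^{−ord_v(·)/n_v}`),
  and «`tq` REALISES `P_q`» means `log ‖t_{q,v}‖' = −P_q(v)·log N(v)/n_v` with `P_q(v) = ord_v(q_v)/(2l)` (Dupuy–Hilado (3.4), §3.3).
  Since `‖F_v^×‖' = N(v)^{(1/n_v)·ℤ}` (abc-iut-S7's norm uniformizer, `exists_isUniformizer_rescaledCompletion`), such a `t_{q,v}` exists
  iff `ord_v(q_v)/(2l) ∈ ℤ`, i.e. **iff `2l ∣ ord_v(q_v)`** — abc-iut-c312-3 proved «if» (`exists_realising_qIdeles`, p420764, recording the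
  condition «as for initial Θ-data, `q̲_v = q_v^{1/2l} ∈ K_v̲`, [IUTchI] Ex. 3.2 (iv) — here `F` plays `K`»); §1 proves «only if»
  (`two_mul_l_dvd_ordq_of_realising`).
* abc-iut-c312-8's provenance `Cor312Prov.IsPilotDataOf D X` (the `hX` of v3/v4/Shrink2/Shrink3) ties `X` to an initial Θ-datum
  `D : InitialThetaData F K F̄ E l Pb` OVER `D`'S FIELD `F` (not over `K = F(E_F[l])`): `X.l = l`, `S = 𝕍(F)^bad`, and
  `ord_v(q_v) = qParamOrd E v = ord_v(Δ_min)` at `v ∈ 𝕍(F)^bad`. But [IUTchI] Def. 3.1 (c), AS TYPED by abc-iut-L5-t2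
  (`InitialThetaData.l_coprime_qParamOrd`: «`l` is prime to the orders of the `q`-parameters of `E_F`»), makes `l` COPRIME to every
  such `ord_v(q_v)`; with `l` prime (`≥ 5`) this forbids `2l ∣ ord_v(q_v)`. Hence (§2) **NO q-ideles over `F` realise `P_q` for the pilot
  data of an initial Θ-datum**: `not_realising_qIdeles_of_isPilotDataOf`. The same computation forbids Θ-ideles realising `P_Θ`
  (`P_{Θ,1} = P_q`): `not_realising_thetaIdeles_of_isPilotDataOf`.
* §3 states the consequence in the certificates' own binder vocabulary: `sideConditions_unsat_of_isPilotDataOf` — the conjunction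
  «`IsPilotDataOf D X` ∧ `htq0` ∧ `htq`» carried by `Conditional.AbcOfSGenuine.cor312Of_of_SH_genuine` (v3's line, p430884),
  `cor312Of_of_S_genuine`, `Conditional.Shrink2.cor312Of_of_S` (p430322), `Conditional.Shrink3.cor312Of_of_SH` (p431459) — and, inside
  the `∃`-bundle `H`, by `abc_of_S_v3` / `abc_of_S_v4` — is FALSE for every `D`, `X`, `tq`. Those theorems are correct and remain
  correct; what this file adds is that, at the genuine data they are written for, their antecedent cannot be met: as statements about
  initial Θ-data they are VACUOUS. (The refutations `PinnedHonestReal.not_pilotKummerIndRelated_settingPrVolSharp_of_pinned` p430714 and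
  `Shrink2.not_S_of_pins_of_realising` p430998 take `X` FREE with realising ideles — consistent and instantiable, e.g. at Dupuy–Hilado
  pilot data over a field in which `2l ∣ ord(q)`, such as `K ⊇ F(E[2l])`; they are NOT instantiable at `X` := the pilot data of `D`
  over `F`.)

WHY PRINT IS NOT TOUCHED: [IUTchI] works over `K = F(E_F[l])` (and `√−1 ∈ F`, `E[2]` rational), where `q̲_v := q_v^{1/2l} ∈ K_v̲`
(Ex. 3.2 (iv)) — the divisibility holds in `K`'s completions by ramification, exactly BECAUSE `l ∤ ord_v(q_v)` in `F`. abc-iut-S2's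
`ThetaVolumeInput` (ideles in `K_{v̲}` through a place section) is typed that way and is inhabited (`ThetaVolumeInput.exists_of_ordq`,
abc-iut-w4-d037). The vacuity is an artefact of composing c312-8's `F`-level provenance with c312-3/c312-7's `F_v`-level idele binders.

REPAIR (for the C lead; not executed here — it needs a definition owner): (R1) a `K`-level provenance `IsPilotDataOfK D (X : PilotData K)`
(`S` = places of `K` over `𝕍^bad_mod`, `ord_w(q) = e(w|v)·ord_v(q_v)`, `l` the same) — c312-3/5/7's containers and `settingPrVolSharp` are
generic in the base field, realising ideles then EXIST (`2l ∣ e(w|v)·ord_v(q_v)`), and the q-number `−deĝ_K(P_q)/[K:ℚ]·… = −(1/2l)·log(q)`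
is degree-normalised hence unchanged (c312-8 `logq_eq_sum_mod` pattern); or (R2) idele-free boxes: parametrise the sharp boxes by the real
radii `N(v)^{−P(v)}` (the boxes depend on `t` only through `‖t‖`), removing the existence question altogether. Until one of these lands,
the C scoreboard must print the genuine-setting lines with «antecedent UNSATISFIABLE as typed (side condition `htq` vs Def. 3.1 (c))».

HONEST FRAMING: a statement about OUR typing (which field the Dupuy–Hilado ideles live in), not about [IUTchIII] Cor. 3.12, not about
any author; nothing here bears on the truth of the Corollary or of abc. typed ≠ proved; instantiated ≠ endorsed.
[cite: Mochizuki2012, IUTchI Def. 3.1 (c) p. 61, Ex. 3.2 (iv) p. 71] [cite: DupuyHilado2025, §3.3, §3.4] [cite: NeukirchANT1999, Ch. II Prop. (6.8)]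
-/

noncomputable section

open Set Function NumberField IsDedekindDomain

namespace Summit.ABC.IUTFork.Conditional.SideVacuity

open Thm311 Thm311.Real Cor312Prov Literature.IUT.LogVolume Literature.IUT.HodgeTheaters
  Literature.NumberTheory.NumberFields

/-! ## §1. The value group of the rescaled norm: a realising idele forces `2l ∣ ord_v(q_v)` -/

section Local

variable {F : Type} [Field F] [NumberField F]

/-- **Integrality of realised exponents.** In the rescaled completion `F_v` (`‖·‖' = N(v)^{−ord_v(·)/n_v}`), if a NON-ZERO element `a`
has `log ‖a‖' = −c·log N(v)/n_v`, then `c` is an INTEGER: every unit is a power of abc-iut-S7's norm uniformizer `ϖ`, `‖ϖ‖' = p^{−1/e}`,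
and `log N(v)/n_v = f·log p/(e·f) = log p/e`. [cite: NeukirchANT1999, Ch. II Prop. (6.8)] -/
theorem exists_int_cast_eq_of_log_norm_eq (p : ℕ) [Fact p.Prime] {v : HeightOneSpectrum (𝓞 F)}
    (hpv : ((p : ℕ) : 𝓞 F) ∈ v.asIdeal) {a : RescaledCompletion F p v hpv} (ha : a ≠ 0) {c : ℝ}
    (h : Real.log ‖a‖ = -c * logNorm F v / localDegree F v) : ∃ k : ℤ, (k : ℝ) = c := by
  obtain ⟨ϖ, hu, hϖ⟩ := exists_isUniformizer_rescaledCompletion F p v hpv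
  obtain ⟨k, hk⟩ := hu.2 (Units.mk0 a ha)
  refine ⟨k, ?_⟩
  have hp : (0 : ℝ) < p := by exact_mod_cast (Fact.out : p.Prime).pos
  have hlogp : Real.log p ≠ 0 := by
    have h1 : (1 : ℝ) < p := by exact_mod_cast (Fact.out : p.Prime).one_lt
    exact (Real.log_pos h1).ne'
  have he : (v.asIdeal.ramificationIdx ℤ : ℝ) ≠ 0 := by exact_mod_cast (Ideal.ramificationIdx_pos _ _).ne'
  have hf : (resDeg F v : ℝ) ≠ 0 := by
    have h0 := localDegree_pos F v
    unfold localDegree at h0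
    exact_mod_cast (Nat.pos_of_ne_zero fun hz => by rw [hz, mul_zero] at h0; exact lt_irrefl 0 h0).ne'
  -- `log ‖a‖' = k · log ‖ϖ‖' = −(k/e)·log p`
  have hka : Real.log ‖a‖ = -(k : ℝ) * (Real.log p / (v.asIdeal.ramificationIdx ℤ : ℝ)) := by
    have : ‖a‖ = ‖(ϖ : RescaledCompletion F p v hpv)‖ ^ k := hk
    rw [this, Real.log_zpow, hϖ, Real.log_rpow hp]
    ring
  -- the hypothesis: `log ‖a‖' = −c·f·log p/(e·f) = −c·log p/e`
  have hca : Real.log ‖a‖ = -c * (Real.log p / (v.asIdeal.ramificationIdx ℤ : ℝ)) := by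
    rw [h, logNorm_eq, residueChar_eq_of_natCast_mem p hpv]
    unfold localDegree
    rw [ramIdx_eq]
    push_cast
    field_simp
  have hM : Real.log p / (v.asIdeal.ramificationIdx ℤ : ℝ) ≠ 0 := div_ne_zero hlogp he
  have := mul_right_cancel₀ hM (hka.symm.trans hca)
  linarith

/-- **Only if.** For Dupuy–Hilado pilot data `X` over `F` and q-ideles `tq` in the rescaled completions `F_v` (abc-iut-c312-3's binders
`tq`, `htq0`, `htq` of `Real.settingDHVolSharp` / `settingPrVolSharp`): if `tq` REALISES `P_q` — `log ‖t_{q,v}‖' = −P_q(v)·log N(v)/n_v` with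
`P_q(v) = ord_v(q_v)/(2l)` — then **`2l ∣ ord_v(q_v)` at every `v ∈ S`**. Converse of abc-iut-c312-3's `exists_realising_qIdeles` (p420764).
[cite: DupuyHilado2025, §3.3, §3.4] [cite: NeukirchANT1999, Ch. II Prop. (6.8)] -/
theorem two_mul_l_dvd_ordq_of_realising (X : PilotData F)
    (tq : ∀ (pp : Nat.Primes) (x : (thetaIndex X).Fibre (.inr pp)), haveI : Fact (pp : ℕ).Prime := ⟨pp.2⟩; kOf X pp.1 x)
    (htq0 : ∀ pp x, tq pp x ≠ 0)
    (htq : ∀ (pp : Nat.Primes) (x : (thetaIndex X).Fibre (.inr pp)),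
      haveI : Fact (pp : ℕ).Prime := ⟨pp.2⟩
      Real.log ‖tq pp x‖ = -(X.qPilot (placeOf X pp.1 x)) * logNorm F (placeOf X pp.1 x) /
        localDegree F (placeOf X pp.1 x))
    {v : HeightOneSpectrum (𝓞 F)} (hv : v ∈ X.S) : (2 * (X.l : ℤ)) ∣ X.ordq v := by
  -- the place `v` as a point `x` of the fibre of `𝕍(F) → 𝕍_ℚ` over its residue characteristic `p`
  haveI hp : Fact (residueChar F v).Prime := ⟨residueChar_prime F v⟩
  have hpv : ((residueChar F v : ℕ) : 𝓞 F) ∈ v.asIdeal := natCast_residueChar_mem F v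
  have hover : v ∈ placesOver F (residueChar F v) :=
    (mem_placesOver_iff v).mpr (liesOver_span_of_natCast_mem F (residueChar F v) v hpv)
  set pp : Nat.Primes := ⟨residueChar F v, residueChar_prime F v⟩ with hpp
  set x : (thetaIndex X).Fibre (.inr pp) := (fibreEquivPlacesOver X pp).symm ⟨v, hover⟩ with hxdef
  have hx : placeOf X (residueChar F v) x = v :=
    congrArg Subtype.val ((fibreEquivPlacesOver X pp).apply_symm_apply ⟨v, hover⟩)
  -- integrality of the realised exponent `P_q(v) = ord_v(q_v)/(2l)`
  obtain ⟨k, hk⟩ := exists_int_cast_eq_of_log_norm_eq (residueChar F v) (natCast_mem_placeOf X (residueChar F v) x)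
    (htq0 pp x) (htq pp x)
  rw [hx, X.qPilot_apply_of_mem hv] at hk
  have hl : (X.l : ℝ) ≠ 0 := by exact_mod_cast X.l_prime.ne_zero
  have hkq : (X.ordq v : ℝ) = 2 * (X.l : ℝ) * k := by
    rw [hk]
    field_simp
  refine ⟨k, ?_⟩
  exact_mod_cast hkq

/-- The Θ-side twin: Θ-ideles REALISING `P_Θ` (`log ‖t_{Θ,j,v}‖' = −P_{Θ,j}(v)·log N(v)/n_v`, `P_{Θ,1} = P_q`) also force `2l ∣ ord_v(q_v)`
on `S` (read at the first label `j = 1`, available since `ℓ⋇ ≥ 2`). Converse of abc-iut-c312-3's `exists_realising_thetaIdeles`.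
[cite: DupuyHilado2025, §3.3, §3.4] -/
theorem two_mul_l_dvd_ordq_of_realising_theta (X : PilotData F)
    (t : ∀ (pp : Nat.Primes) (_ : Fin X.lstar) (x : (thetaIndex X).Fibre (.inr pp)),
      haveI : Fact (pp : ℕ).Prime := ⟨pp.2⟩; kOf X pp.1 x)
    (ht0 : ∀ pp i x, t pp i x ≠ 0)
    (ht : ∀ (pp : Nat.Primes) (i : Fin X.lstar) (x : (thetaIndex X).Fibre (.inr pp)),
      haveI : Fact (pp : ℕ).Prime := ⟨pp.2⟩
      Real.log ‖t pp i x‖ = -(X.thetaPilot i (placeOf X pp.1 x)) * logNorm F (placeOf X pp.1 x) /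
        localDegree F (placeOf X pp.1 x))
    {v : HeightOneSpectrum (𝓞 F)} (hv : v ∈ X.S) : (2 * (X.l : ℤ)) ∣ X.ordq v := by
  haveI hp : Fact (residueChar F v).Prime := ⟨residueChar_prime F v⟩
  have hpv : ((residueChar F v : ℕ) : 𝓞 F) ∈ v.asIdeal := natCast_residueChar_mem F v
  have hover : v ∈ placesOver F (residueChar F v) :=
    (mem_placesOver_iff v).mpr (liesOver_span_of_natCast_mem F (residueChar F v) v hpv)
  set pp : Nat.Primes := ⟨residueChar F v, residueChar_prime F v⟩ with hpp
  set x : (thetaIndex X).Fibre (.inr pp) := (fibreEquivPlacesOver X pp).symm ⟨v, hover⟩ with hxdef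
  have hx : placeOf X (residueChar F v) x = v :=
    congrArg Subtype.val ((fibreEquivPlacesOver X pp).apply_symm_apply ⟨v, hover⟩)
  -- the first label `j = 1` (index `i = 0`), where `P_{Θ,1} = P_q`
  have hl0 : 0 < X.lstar := lt_of_lt_of_le (by norm_num) X.two_le_lstar
  obtain ⟨k, hk⟩ := exists_int_cast_eq_of_log_norm_eq (residueChar F v) (natCast_mem_placeOf X (residueChar F v) x)
    (ht0 pp ⟨0, hl0⟩ x) (ht pp ⟨0, hl0⟩ x)
  rw [hx, X.thetaPilot_apply_of_mem ⟨0, hl0⟩ hv] at hk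
  have hl : (X.l : ℝ) ≠ 0 := by exact_mod_cast X.l_prime.ne_zero
  have hkq : (X.ordq v : ℝ) = 2 * (X.l : ℝ) * k := by
    rw [hk]
    push_cast
    field_simp
    ring
  refine ⟨k, ?_⟩
  exact_mod_cast hkq

end Local

/-! ## §2. … which [IUTchI] Def. 3.1 (c) forbids for the pilot data OF an initial Θ-datum over its own field -/

section Genuine

variable {F K Fbar : Type} [Field F] [NumberField F] [Field K] [NumberField K] [Algebra F K] [Field Fbar]
  [Algebra F Fbar] [Algebra K Fbar] {E : WeierstrassCurve F} [E.IsElliptic] {l : ℕ} {Pb : BadPlacePredicates K}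
  (D : InitialThetaData F K Fbar E l Pb) (X : PilotData F)

/-- **Def. 3.1 (c) vs `2l ∣ ord_v(q_v)`.** For the pilot data `X` OF an initial Θ-datum `D` over `F` (`Cor312Prov.IsPilotDataOf D X`:
`l` the same, `S = 𝕍(F)^bad`, `ord_v(q_v) = qParamOrd E v`), `2l` divides NO `ord_v(q_v)`, `v ∈ S`: Def. 3.1 (c) as typed
(`InitialThetaData.l_coprime_qParamOrd`) makes the prime `l` coprime to it. [cite: Mochizuki2012, IUTchI Def. 3.1 (c) p. 61] -/
theorem not_two_mul_l_dvd_ordq_of_isPilotDataOf (hX : IsPilotDataOf D X) {v : HeightOneSpectrum (𝓞 F)} (hv : v ∈ X.S) :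
    ¬ (2 * (X.l : ℤ)) ∣ X.ordq v := by
  intro hdvd
  -- `v` as a `FinitePlace`, in `𝕍(F)^bad`
  have hwS : (FinitePlace.mk v).maximalIdeal ∈ X.S := by rwa [FinitePlace.maximalIdeal_mk]
  have hw : FinitePlace.mk v ∈ D.VFbad := (hX.mem_S_iff _).mp hwS
  have hcop : l.Coprime (qParamOrd E v) := by
    have := D.l_coprime_qParamOrd (FinitePlace.mk v) hw
    rwa [FinitePlace.maximalIdeal_mk] at this
  have hord : X.ordq v = (qParamOrd E v : ℤ) := by
    have := hX.ordq_eq (FinitePlace.mk v) hw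
    rwa [FinitePlace.maximalIdeal_mk] at this
  -- `l ∣ 2l ∣ ord_v(q_v) = qParamOrd E v`, contradicting coprimality for the prime `l`
  have hl_dvd : (l : ℤ) ∣ (qParamOrd E v : ℤ) := by
    rw [← hord, ← hX.l_eq]
    exact (dvd_mul_left (X.l : ℤ) 2).trans hdvd
  have hl1 : l = 1 := hcop.eq_one_of_dvd (Int.natCast_dvd_natCast.mp hl_dvd)
  exact D.l_prime.ne_one hl1

/-- **NO q-ideles over `F` realise `P_q` for the pilot data of an initial Θ-datum.** With `hX : IsPilotDataOf D X`, abc-iut-c312-3's /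
c312-7's binder group «`tq` non-zero (`htq0`) and realising `P_q` (`htq`)» is UNSATISFIABLE (`S ≠ ∅`, §1, and Def. 3.1 (c)).
[cite: Mochizuki2012, IUTchI Def. 3.1 (c) p. 61, Ex. 3.2 (iv) p. 71] [cite: DupuyHilado2025, §3.4] -/
theorem not_realising_qIdeles_of_isPilotDataOf (hX : IsPilotDataOf D X)
    (tq : ∀ (pp : Nat.Primes) (x : (thetaIndex X).Fibre (.inr pp)), haveI : Fact (pp : ℕ).Prime := ⟨pp.2⟩; kOf X pp.1 x)
    (htq0 : ∀ pp x, tq pp x ≠ 0) :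
    ¬ (∀ (pp : Nat.Primes) (x : (thetaIndex X).Fibre (.inr pp)),
      haveI : Fact (pp : ℕ).Prime := ⟨pp.2⟩
      Real.log ‖tq pp x‖ = -(X.qPilot (placeOf X pp.1 x)) * logNorm F (placeOf X pp.1 x) /
        localDegree F (placeOf X pp.1 x)) := by
  intro htq
  obtain ⟨v, hv⟩ := X.S_nonempty
  exact not_two_mul_l_dvd_ordq_of_isPilotDataOf D X hX hv (two_mul_l_dvd_ordq_of_realising X tq htq0 htq hv)

/-- **NO Θ-ideles over `F` realise `P_Θ` for the pilot data of an initial Θ-datum** (the `ht` of the S-form refutations p430714 /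
p430998, read at `X` := the pilot data of `D`): unsatisfiable for the same reason. [cite: Mochizuki2012, IUTchI Def. 3.1 (c) p. 61] -/
theorem not_realising_thetaIdeles_of_isPilotDataOf (hX : IsPilotDataOf D X)
    (t : ∀ (pp : Nat.Primes) (_ : Fin X.lstar) (x : (thetaIndex X).Fibre (.inr pp)),
      haveI : Fact (pp : ℕ).Prime := ⟨pp.2⟩; kOf X pp.1 x)
    (ht0 : ∀ pp i x, t pp i x ≠ 0) :
    ¬ (∀ (pp : Nat.Primes) (i : Fin X.lstar) (x : (thetaIndex X).Fibre (.inr pp)),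
      haveI : Fact (pp : ℕ).Prime := ⟨pp.2⟩
      Real.log ‖t pp i x‖ = -(X.thetaPilot i (placeOf X pp.1 x)) * logNorm F (placeOf X pp.1 x) /
        localDegree F (placeOf X pp.1 x)) := by
  intro ht
  obtain ⟨v, hv⟩ := X.S_nonempty
  exact not_two_mul_l_dvd_ordq_of_isPilotDataOf D X hX hv (two_mul_l_dvd_ordq_of_realising_theta X t ht0 ht hv)

/-! ## §3. Consequence for the certificates of record: their per-datum side conditions cannot be met at any genuine datum -/

/-- **The per-datum SIDE-condition group of the «genuine-setting» certificates is unsatisfiable.** The conjunction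
«`Cor312Prov.IsPilotDataOf D X` ∧ (q-ideles non-zero) ∧ (q-ideles realise `P_q`)» — hypotheses `hX`, `htq0`, `htq` of
`Conditional.cor312Of_of_SH_genuine` / `cor312Of_of_S_genuine` (abc-iut-C-cert-2, p430884), `Conditional.Shrink2.cor312Of_of_S` (p430322),
`Conditional.Shrink3.cor312Of_of_SH` (p431459), and, inside the `∃`-bundle `H`, of `abc_of_S_v3` / `abc_of_S_v4` — holds for NO `D`, `X`, `tq`.
Those theorems stand; AT THE DATA THEY ARE WRITTEN FOR their antecedent is empty — the certificates are vacuous as typed until the idele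
binders are moved to `K`-completions (R1) or replaced by real radii (R2), module docstring. No side taken on [IUTchIII] Cor. 3.12 or any
author; a statement about OUR typing. [cite: Mochizuki2012, IUTchI Def. 3.1 (c) p. 61, Ex. 3.2 (iv) p. 71] -/
theorem sideConditions_unsat_of_isPilotDataOf
    (tq : ∀ (pp : Nat.Primes) (x : (thetaIndex X).Fibre (.inr pp)), haveI : Fact (pp : ℕ).Prime := ⟨pp.2⟩; kOf X pp.1 x) :
    ¬ (IsPilotDataOf D X ∧ (∀ pp x, tq pp x ≠ 0) ∧
      ∀ (pp : Nat.Primes) (x : (thetaIndex X).Fibre (.inr pp)),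
        haveI : Fact (pp : ℕ).Prime := ⟨pp.2⟩
        Real.log ‖tq pp x‖ = -(X.qPilot (placeOf X pp.1 x)) * logNorm F (placeOf X pp.1 x) /
          localDegree F (placeOf X pp.1 x)) :=
  fun h => not_realising_qIdeles_of_isPilotDataOf D X h.1 tq h.2.1 h.2.2

/-- In particular for abc-iut-c312-8's CANONICAL pilot data `pilotDataOfF D` (p418726): no realising q-ideles over `F`.
[cite: Mochizuki2012, IUTchI Def. 3.1 (c) p. 61] -/
theorem not_realising_qIdeles_pilotDataOfF
    (tq : ∀ (pp : Nat.Primes) (x : (thetaIndex (pilotDataOfF D)).Fibre (.inr pp)),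
      haveI : Fact (pp : ℕ).Prime := ⟨pp.2⟩; kOf (pilotDataOfF D) pp.1 x)
    (htq0 : ∀ pp x, tq pp x ≠ 0) :
    ¬ (∀ (pp : Nat.Primes) (x : (thetaIndex (pilotDataOfF D)).Fibre (.inr pp)),
      haveI : Fact (pp : ℕ).Prime := ⟨pp.2⟩
      Real.log ‖tq pp x‖ = -((pilotDataOfF D).qPilot (placeOf (pilotDataOfF D) pp.1 x)) *
        logNorm F (placeOf (pilotDataOfF D) pp.1 x) / localDegree F (placeOf (pilotDataOfF D) pp.1 x)) :=
  not_realising_qIdeles_of_isPilotDataOf D (pilotDataOfF D) (isPilotDataOf_pilotDataOfF D) tq htq0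

end Genuine

end Summit.ABC.IUTFork.Conditional.SideVacuity

end
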